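import Summits.PneNP.PneNP.Theorems.ChebyshevTracialDesignProjectionNormalForm
import Summits.PneNP.PneNP.Theorems.ChebyshevTracialDesignBoundedDimension
import Summits.PneNP.PneNP.Theses.ChebyshevTracialDesign
import HarnessLib

/-!
# Cell pnp-psdrank, route `ChebyshevTracialDesign`: the crux `TracialDecayExp20` (stmt-PneNP-19878) is EQUIVALENT to its restriction
# to projection-valued strategies

Brick 35c (prover g9; leaf file — imports the route file, nothing should import this). By the projection normal form (brick 35b,
`exists_projection_dilation`: every tight-orthogonal psd rectangle of dimension `r` has a projection-valued twin of dimension `3r` with the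
same traces) the crux may be stated for families of ORTHOGONAL PROJECTIONS only — subspaces `A_U, B_M ≤ ℝ^r` with `A_U ⊥ B_M` on the tight
pairs and value `(1/r) Σ_{U,M} W(U,M) ‖P_{A_U} P_{B_M}‖_F²`:

  `TracialDecayExp20 ↔ ∃ a > 0, ∀ large even n, ∀ balanced B = 20 designs, ∀ r ≥ 1 with r²n < exp(a·dq n), ∀ tight psd rectangles (P, Q)
   of dimension r with P_U² = P_U, Q_M² = Q_M: value/r ≤ exp(−a·dq n)`          (`tracialDecayExp20_iff_projections`).

`→` is restriction; `←` halves the rate: a dimension-`r` strategy in the budget of `a/2` dilates to dimension `3r`, inside the budget of `a`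
once `exp(a·dq n/2) ≥ 9`, and `3·exp(−a·dq n) ≤ exp(−(a/2)·dq n)`. [cite: BrietDadushPokutta2014, Thm. 6 (§3)]
[cite: GriblingDelaatLaurent2019, §5] [cite: Rothvoss2017, §2 (PDF pp. 6–7)]
Stature: support/instrument (a reformulation of the open crux). WHAT THIS IS NOT: no progress on the crux's truth, nothing on psd rank of
P_PM, no P-vs-NP content.
-/

set_option linter.dupNamespace false -- `Summit.PneNP.PneNP.…`: summit = sub-problem (D-0017)

noncomputable section

namespace Summit.PneNP.PneNP.Theorems.ChebyshevTracialDesignProjectionCrux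

open Finset Matrix Literature.Barriers.PneNP Literature.Combinatorics.Optimization
open Summit.PneNP.PneNP.Theorems.ChebyshevTracialDesignProjectionNormalForm (exists_projection_dilation)
open Summit.PneNP.PneNP.Theorems.ChebyshevTracialDesignBoundedDim (le_dq_of_pow_le)

/-- Threshold arithmetic: for `n ≥ ⌈16/a⌉₊⁴` one has `8 ≤ (a/2)·dq n`, hence `9 ≤ exp((a/2)·dq n)`. -/
theorem budget_threshold {a : ℝ} (ha : 0 < a) {n : ℕ} (hn : (⌈16 / a⌉₊) ^ 4 ≤ n) :
    8 ≤ a / 2 * (dq n : ℝ) ∧ 9 ≤ Real.exp (a / 2 * (dq n : ℝ)) := by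
  have hK : (⌈16 / a⌉₊ : ℝ) ≤ (dq n : ℝ) := by exact_mod_cast le_dq_of_pow_le hn
  have h16 : 16 / a ≤ (dq n : ℝ) := (Nat.le_ceil _).trans hK
  have h8 : 8 ≤ a / 2 * (dq n : ℝ) := by
    have := mul_le_mul_of_nonneg_left h16 (by positivity : (0 : ℝ) ≤ a / 2)
    calc (8 : ℝ) = a / 2 * (16 / a) := by field_simp; ring
      _ ≤ a / 2 * (dq n : ℝ) := this
  exact ⟨h8, by linarith [Real.add_one_le_exp (a / 2 * (dq n : ℝ))]⟩

/-- **The crux ⟺ its projection-valued restriction.** [cite: BrietDadushPokutta2014, Thm. 6 (§3)] [cite: GriblingDelaatLaurent2019, §5] -/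
theorem tracialDecayExp20_iff_projections :
    Summit.PneNP.PneNP.Theses.ChebyshevTracialDesign.TracialDecayExp20 ↔
      ∃ a : ℝ, 0 < a ∧ ∃ n₁ : ℕ, ∀ n : ℕ, n₁ ≤ n → Even n → ∀ (t : ℕ) (C : Finset ℕ) (w : ℕ → ℝ),
        IsBalancedDesign n t (Tq n) (dq n) 20 C w → ∀ r : ℕ, 0 < r → (r : ℝ) ^ 2 * n < Real.exp (a * (dq n : ℝ)) →
          ∀ (P : OddSet n → Matrix (Fin r) (Fin r) ℝ) (Q : PMatch n → Matrix (Fin r) (Fin r) ℝ), IsPsdRect P Q →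
            (∀ U, P U * P U = P U) → (∀ M, Q M * Q M = Q M) →
              (∑ U, ∑ M, levelWeight n t C w U M * (P U * Q M).trace) / r ≤ Real.exp (-(a * (dq n : ℝ))) := by
  constructor
  · rintro ⟨a, ha, n₁, h⟩
    exact ⟨a, ha, n₁, fun n hn hev t C w hdes r hr hbud P Q hPQ _ _ => h n hn hev t C w hdes r hr hbud P Q hPQ⟩
  · rintro ⟨a, ha, n₁, h⟩
    refine ⟨a / 2, by positivity, max n₁ ((⌈16 / a⌉₊) ^ 4), fun n hn hev t C w hdes r hr hbud X Y hXY => ?_⟩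
    have hn1 : n₁ ≤ n := le_trans (le_max_left _ _) hn
    obtain ⟨h8, h9⟩ := budget_threshold ha (le_trans (le_max_right _ _) hn)
    have hr' : (0 : ℝ) < r := by exact_mod_cast hr
    -- the dilated dimension `3r` is inside the budget of rate `a`
    have hbud3 : ((3 * r : ℕ) : ℝ) ^ 2 * n < Real.exp (a * (dq n : ℝ)) := by
      have hsq : Real.exp (a * (dq n : ℝ)) = Real.exp (a / 2 * (dq n : ℝ)) * Real.exp (a / 2 * (dq n : ℝ)) := by
        rw [← Real.exp_add]; ring_nf
      calc ((3 * r : ℕ) : ℝ) ^ 2 * n = 9 * ((r : ℝ) ^ 2 * n) := by push_cast; ring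
        _ < 9 * Real.exp (a / 2 * (dq n : ℝ)) := mul_lt_mul_of_pos_left hbud (by norm_num)
        _ ≤ Real.exp (a / 2 * (dq n : ℝ)) * Real.exp (a / 2 * (dq n : ℝ)) :=
            mul_le_mul_of_nonneg_right h9 (Real.exp_pos _).le
        _ = Real.exp (a * (dq n : ℝ)) := hsq.symm
    -- dilate, apply the projection-restricted bound in dimension `3r`, come back
    obtain ⟨P, Q, hPQ, hP, hQ, htr⟩ := exists_projection_dilation hXY
    have h3r : 0 < 3 * r := by omega
    have hv := h n hn1 hev t C w hdes (3 * r) h3r hbud3 P Q hPQ hP hQ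
    have h3r' : (0 : ℝ) < ((3 * r : ℕ) : ℝ) := by exact_mod_cast h3r
    rw [div_le_iff₀ h3r'] at hv
    have e : ∑ U, ∑ M, levelWeight n t C w U M * (X U * Y M).trace =
        ∑ U, ∑ M, levelWeight n t C w U M * (P U * Q M).trace :=
      sum_congr rfl fun U _ => sum_congr rfl fun M _ => by rw [htr U M]
    rw [e, div_le_iff₀ hr']
    -- `3·exp(−aD) ≤ exp(−(a/2)D)` since `exp((a/2)D) ≥ 9 ≥ 3`
    have h3 : 3 * Real.exp (-(a * (dq n : ℝ))) ≤ Real.exp (-(a / 2 * (dq n : ℝ))) := by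
      have hsplit : Real.exp (-(a * (dq n : ℝ))) = Real.exp (-(a / 2 * (dq n : ℝ))) * Real.exp (-(a / 2 * (dq n : ℝ))) := by
        rw [← Real.exp_add]; ring_nf
      have hinv : Real.exp (-(a / 2 * (dq n : ℝ))) * 3 ≤ 1 := by
        rw [Real.exp_neg]
        calc (Real.exp (a / 2 * (dq n : ℝ)))⁻¹ * 3 ≤ (Real.exp (a / 2 * (dq n : ℝ)))⁻¹ * Real.exp (a / 2 * (dq n : ℝ)) :=
              mul_le_mul_of_nonneg_left (by linarith) (inv_nonneg.2 (Real.exp_pos _).le)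
          _ = 1 := inv_mul_cancel₀ (Real.exp_pos _).ne'
      rw [hsplit]
      nlinarith [Real.exp_pos (-(a / 2 * (dq n : ℝ))), hinv]
    calc ∑ U, ∑ M, levelWeight n t C w U M * (P U * Q M).trace ≤ Real.exp (-(a * (dq n : ℝ))) * ((3 * r : ℕ) : ℝ) := hv
      _ = 3 * Real.exp (-(a * (dq n : ℝ))) * r := by push_cast; ring
      _ ≤ Real.exp (-(a / 2 * (dq n : ℝ))) * r := mul_le_mul_of_nonneg_right h3 hr'.le

end Summit.PneNP.PneNP.Theorems.ChebyshevTracialDesignProjectionCrux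

end
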